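import Summits.RiemannHypothesis.RiemannHypothesis.Theorems.WeilBlockHpLegendreCoeff
import HarnessLib

/-!
# The Bessel-block claim rows `Hp = C H Cᵀ` of a Weil certificate ARE Legendre orthogonality

Purpose (GroundBarta / Weil-positivity block certificates, prover B g9 kernel-cost lever, RH-free): the Bessel-block claim rows
`Hp = C H Cᵀ` of a `WeilCert` (`WeilCert.checkHpRow`, Literature/NumberTheory/LFunctions/WeilBlockRowsPZ.lean) were verified numerically
row by row (`checkHpRowT`, ≈ 40 s of kernel time per row, 28 one-parity files per `nb = 136` certificate). Row `i` of `C` being the coefficient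
list of the Legendre polynomial `P_{2i+p}` in the powers `y^{2k+p}`, the claim IS Legendre orthogonality; these two files prove it once and
for all and replace the row files by ONE kernel identity `c.Cb p = legendreTable p nb` per parity.

This file: `eval_legendre_eq_sum_parity` (`P_{2i+p}(x) = Σ_{k<N} c(2i+p,2k+p) x^{2k+p}`), `legendre_gram_sum` (the Gram double sum
`Σ_k Σ_l c_ik c_jl · 2a/((2k+p)+(2l+p)+1) = a ∫_{-1}^1 P_{2i+p} P_{2j+p} = [i=j]·2a/(2(2i+p)+1)`, from
`integral_legendre_mul_legendre_eq_zero` / `integral_legendre_sq`), and the bridges **`checkHpRows_of_legendre`** /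
**`checkHpRows_of_legendreTable`**: `c.Cb p = legendreTable p c.nb` and `Hp` the diagonal table ⇒ `∀ i < nb, c.checkHpRow Hp p i = true`.
Everything here is proved. [folklore]
-/

set_option linter.dupNamespace false

noncomputable section

open Polynomial Finset MeasureTheory intervalIntegral
open scoped Nat BigOperators

namespace Summit.RiemannHypothesis.RiemannHypothesis.Theorems.HpLegendre

open Literature.Analysis.SpecialFunctions Literature.NumberTheory.LFunctions

/-! ## `P_{2i+p}` as a sum over the powers `x^{2k+p}`, `k < N` -/

/-- For `i < N` and `p ≤ 1`: `P_{2i+p}(x) = Σ_{k<N} legendreCoeffQ (2i+p) (2k+p) · x^{2k+p}`. [folklore] -/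
theorem eval_legendre_eq_sum_parity {p : ℕ} (hp : p ≤ 1) {N i : ℕ} (hi : i < N) (x : ℝ) :
    (legendre (2 * i + p)).eval x = ∑ k ∈ range N, (legendreCoeffQ (2 * i + p) (2 * k + p) : ℝ) * x ^ (2 * k + p) := by
  have hdeg : (legendre (2 * i + p)).natDegree < 2 * N + p := by
    rw [natDegree_legendre]; omega
  rw [eval_eq_sum_range' hdeg]
  simp only [coeff_legendre]
  -- keep only the exponents `a = 2k + p`, `k < N`
  have hT : (range N).image (fun k ↦ 2 * k + p) ⊆ range (2 * N + p) := by
    intro a ha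
    obtain ⟨k, hk, rfl⟩ := Finset.mem_image.1 ha
    exact Finset.mem_range.2 (by have := Finset.mem_range.1 hk; omega)
  rw [← Finset.sum_subset hT]
  · rw [Finset.sum_image (fun k _ l _ h ↦ by omega)]
  · intro a ha hnot
    have ha' := Finset.mem_range.1 ha
    have hpar : ¬ Even (a + (2 * i + p)) := by
      intro hev
      apply hnot
      obtain ⟨m, hm⟩ := hev
      refine Finset.mem_image.2 ⟨(a - p) / 2, Finset.mem_range.2 (by omega), by omega⟩
    rw [legendreCoeffQ_eq_zero_of_parity hpar, Rat.cast_zero, zero_mul]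

/-! ## The Gram double sum is `a ∫_{-1}^{1} P_{2i+p} P_{2j+p}` -/

/-- `∫_{-1}^{1} x^{2m} dx = 2/(2m+1)`. [folklore] -/
theorem integral_pow_even (m : ℕ) : ∫ x in (-1 : ℝ)..1, x ^ (2 * m) = 2 / (2 * m + 1) := by
  rw [integral_pow]
  rw [show (-1 : ℝ) ^ (2 * m + 1) = -1 from by rw [pow_succ, pow_mul]; norm_num]
  push_cast
  ring

/-- The Gram double sum of the coefficient rows against `2a/((2k+p)+(2l+p)+1)` is `a ∫ P_{2i+p} P_{2j+p}`. [folklore] -/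
theorem legendre_gram_sum_eq_integral {p : ℕ} (hp : p ≤ 1) {N i j : ℕ} (hi : i < N) (hj : j < N) (a : ℝ) :
    ∑ k ∈ range N, ∑ l ∈ range N, (legendreCoeffQ (2 * i + p) (2 * k + p) : ℝ) * (legendreCoeffQ (2 * j + p) (2 * l + p) : ℝ) *
        (2 * a / (((2 * k + p : ℕ) : ℝ) + ((2 * l + p : ℕ) : ℝ) + 1))
      = a * ∫ x in (-1 : ℝ)..1, (legendre (2 * i + p)).eval x * (legendre (2 * j + p)).eval x := by
  -- expand both Legendre polynomials and integrate termwise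
  have hint : ∫ x in (-1 : ℝ)..1, (legendre (2 * i + p)).eval x * (legendre (2 * j + p)).eval x
      = ∑ k ∈ range N, ∑ l ∈ range N, (legendreCoeffQ (2 * i + p) (2 * k + p) : ℝ) * (legendreCoeffQ (2 * j + p) (2 * l + p) : ℝ) *
          (2 / (2 * ((k + l + p : ℕ) : ℝ) + 1)) := by
    have hfun : ∀ x : ℝ, (legendre (2 * i + p)).eval x * (legendre (2 * j + p)).eval x
        = ∑ k ∈ range N, ∑ l ∈ range N, (legendreCoeffQ (2 * i + p) (2 * k + p) : ℝ) * (legendreCoeffQ (2 * j + p) (2 * l + p) : ℝ) *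
            x ^ (2 * (k + l + p)) := by
      intro x
      rw [eval_legendre_eq_sum_parity hp hi, eval_legendre_eq_sum_parity hp hj, Finset.sum_mul_sum]
      refine Finset.sum_congr rfl fun k _ ↦ Finset.sum_congr rfl fun l _ ↦ ?_
      rw [show 2 * (k + l + p) = (2 * k + p) + (2 * l + p) by ring, pow_add]
      ring
    simp_rw [hfun]
    rw [intervalIntegral.integral_finsetSum (fun k _ ↦ ?_)]
    · refine Finset.sum_congr rfl fun k _ ↦ ?_
      rw [intervalIntegral.integral_finsetSum (fun l _ ↦ ?_)]
      · refine Finset.sum_congr rfl fun l _ ↦ ?_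
        rw [intervalIntegral.integral_const_mul, integral_pow_even]
      · exact (continuous_const.mul (continuous_pow _)).intervalIntegrable _ _
    · exact (continuous_finsetSum _ fun l _ ↦ continuous_const.mul (continuous_pow _)).intervalIntegrable _ _
  rw [hint, Finset.mul_sum]
  refine Finset.sum_congr rfl fun k _ ↦ ?_
  rw [Finset.mul_sum]
  refine Finset.sum_congr rfl fun l _ ↦ ?_
  push_cast
  ring

/-- **The Gram double sum is diagonal**: `[i = j] · 2a/(2(2i+p)+1)`. [folklore] -/
theorem legendre_gram_sum {p : ℕ} (hp : p ≤ 1) {N i j : ℕ} (hi : i < N) (hj : j < N) (a : ℝ) :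
    ∑ k ∈ range N, ∑ l ∈ range N, (legendreCoeffQ (2 * i + p) (2 * k + p) : ℝ) * (legendreCoeffQ (2 * j + p) (2 * l + p) : ℝ) *
        (2 * a / (((2 * k + p : ℕ) : ℝ) + ((2 * l + p : ℕ) : ℝ) + 1))
      = if i = j then 2 * a / (2 * ((2 * i + p : ℕ) : ℝ) + 1) else 0 := by
  rw [legendre_gram_sum_eq_integral hp hi hj]
  by_cases hij : i = j
  · subst hij
    rw [if_pos rfl]
    simp_rw [← pow_two]
    rw [integral_legendre_sq]
    push_cast
    ring
  · rw [if_neg hij]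
    rcases Nat.lt_or_gt_of_ne hij with h | h
    · rw [show (fun x ↦ (legendre (2 * i + p)).eval x * (legendre (2 * j + p)).eval x)
          = fun x ↦ (legendre (2 * j + p)).eval x * (legendre (2 * i + p)).eval x from funext fun x ↦ mul_comm _ _]
      rw [integral_legendre_mul_legendre_eq_zero (by omega), mul_zero]
    · rw [integral_legendre_mul_legendre_eq_zero (by omega), mul_zero]

/-! ## The certificate's claim rows -/

/-- **`checkHpRow` from the Legendre coefficient table.** If row `i` of `C = c.Cb p` lists the coefficients of `P_{2i+p}` in the powers
`y^{2k+p}` (`k < nb`) and `Hp` is the diagonal table `2a₀/(2(2i+p)+1)`, every claim row `Hp = C H Cᵀ` holds. [folklore] -/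
theorem checkHpRows_of_legendre (c : WeilCert) {p : ℕ} (hp : p ≤ 1)
    {Hp : List (List ℚ)}
    (hC : ∀ i < c.nb, ∀ k < c.nb, getM (c.Cb p) i k = legendreCoeffQ (2 * i + p) (2 * k + p))
    (hHp : ∀ i < c.nb, ∀ j < c.nb, getM Hp i j = if i = j then 2 * c.a0 / (2 * ((2 * i + p : ℕ) : ℚ) + 1) else 0) :
    ∀ i < c.nb, c.checkHpRow Hp p i = true := by
  intro i hi
  unfold WeilCert.checkHpRow
  refine WeilCert2.allBelow_of_forall fun j hj ↦ ?_
  rw [decide_eq_true_eq, hHp i hi j hj]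
  -- the right-hand side, entrywise
  have hch : ∀ l < c.nb, getV (c.chRow p i) l = sumR c.nb fun k ↦ getM (c.Cb p) i k * c.hBlkQ p k l := by
    intro l hl
    unfold WeilCert.chRow
    rw [getV_tabV _ hl]
  -- cast to ℝ
  apply Rat.cast_injective (α := ℝ)
  rw [sumR_eq_sum]
  push_cast
  rw [Finset.sum_congr rfl fun l hl ↦ by rw [hch l (Finset.mem_range.1 hl), sumR_eq_sum]]
  push_cast
  have hrhs : ∑ l ∈ range c.nb, (∑ k ∈ range c.nb, (getM (c.Cb p) i k : ℝ) * (c.hBlkQ p k l : ℝ)) * (getM (c.Cb p) j l : ℝ)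
      = ∑ k ∈ range c.nb, ∑ l ∈ range c.nb, (legendreCoeffQ (2 * i + p) (2 * k + p) : ℝ) *
          (legendreCoeffQ (2 * j + p) (2 * l + p) : ℝ) * (2 * (c.a0 : ℝ) / (((2 * k + p : ℕ) : ℝ) + ((2 * l + p : ℕ) : ℝ) + 1)) := by
    simp_rw [Finset.sum_mul]
    rw [Finset.sum_comm]
    refine Finset.sum_congr rfl fun k hk ↦ ?_
    refine Finset.sum_congr rfl fun l hl ↦ ?_
    rw [hC i hi k (Finset.mem_range.1 hk), hC j hj l (Finset.mem_range.1 hl)]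
    unfold WeilCert.hBlkQ
    push_cast
    ring
  rw [hrhs, legendre_gram_sum hp hi hj]
  split_ifs <;> push_cast <;> ring


/-- **`checkHpRow` from the identity `c.Cb p = legendreTable p nb`** (one `decide` per certificate and parity). [folklore] -/
theorem checkHpRows_of_legendreTable (c : WeilCert) {p : ℕ} (hp : p ≤ 1) {Hp : List (List ℚ)}
    (hC : c.Cb p = legendreTable p c.nb)
    (hHp : ∀ i < c.nb, ∀ j < c.nb, getM Hp i j = if i = j then 2 * c.a0 / (2 * ((2 * i + p : ℕ) : ℚ) + 1) else 0) :
    ∀ i < c.nb, c.checkHpRow Hp p i = true :=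
  checkHpRows_of_legendre c hp (fun i hi k _ ↦ by rw [hC]; exact getM_legendreTable hp hi k) hHp

end Summit.RiemannHypothesis.RiemannHypothesis.Theorems.HpLegendre

-- build note (sr-gb-rung-b B g14, 2026-08-24T19:45Z): comment-only re-land under the LEAD LOCATED EXCEPTION to R15-0 (2a) (rh-explicit INBOX l.5563 / OPS-REQUESTS 19:02Z, class (ii): accepted through the gate deferred->retry path, never enqueued for the post-accept build); all declarations above are byte-identical to the accepted file.
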